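import Summits.QuantumFields.YangMills.Theorems.BalabanUVNodesN15KingModelAnalyticBlockCovPackage
import Summits.QuantumFields.YangMills.Theorems.BalabanUVNodesN15KingModelCovariantSpectralBounds
import HarnessLib

/-!
# BalabanUVNodes ∕ N15 — THE KING-MODEL RUNG (PART Ϫ-j): THE ZERO MODE OF NE2's UNIT LAYER — at the trivial background the fibre-constant block fields are EXACT eigenvectors:
# `Q(1)` and `Q♯_K(1)` carry constants to constants, the massive fine covariance gives `m⁻²`, so ★★★ `(Δ_eff(1))⁻¹·const = (a⁻¹ + m⁻²)·const` (block-spin noise plus the FULL infrared pole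
# of the fine field) and `Δ_eff(1)·const = (am²∕(a+m²))·const`; hence ★★★★ `‖(Δ_eff(1))⁻¹‖ = a⁻¹ + m⁻²` EXACTLY — PART Ϥ-k's sandwich `a⁻¹ ≤ (Δ_eff)⁻¹ ≤ a⁻¹+m⁻²` and PART Ϫ-c's operator bound
# are ATTAINED, PART Ϫ-h's `η`-uniform form floor `β₁` is necessarily `≤ am²∕(a+m²)`, and the zero-mode covariance diverges as `m² → 0`: the window of the PART closes with the fine mass
# for a reason, not by accident of the method
# (Track A, DAG node N15 = NE2; FAN-OUT v1.1 §N15 s3 «KING-MODEL RUNG … + what the curved case adds»; count-neutral)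

HONEST FRAMING.  Count-neutral (cell `pub-ymgap`, seat `pub-ymgap-dag-n15-e` g52; `--supports stmt-QuantumFields-27247 --as helper` = K3ᴬ, KEY MAP v3).  King's one-level comparison model
at `U ≡ 1` (every tree contour system, every volume, any fibre, King's scaling irrelevant here: any `c`); exact linear algebra of the constant mode.  NOT Bałaban's multi-level `C^{(k)}`;
NOT a node discharge (N15 of record untouched); nothing continuum ∕ ℝ⁴ ∕ OS ∕ Clay.

THE RESULTS (`e : n → 𝕜` a fibre vector, `const_e` the field `(x,i) ↦ e_i`):
* §1 THE BLOCK MAPS ON CONSTANTS: ★ `covQ_one_mulVec_const` (`Q(1)·const_e = const_e` on the block lattice), ★ `cxKingQadj_one_mulVec_const` (`Q♯_K(1)·const_e = const_e` on the fine lattice),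
  `covLapF_one_inv_mulVec_const` (`(−cΔ+m²)⁻¹const_e = m⁻²const_e`, `m² > 0`).
* §2 ★★★ **`cxBlockCov_one_mulVec_const`** (`C(1,1)·const_e = (a⁻¹ + m⁻²)·const_e`), ★★★ **`effLapU_one_inv_mulVec_const`** (`(Δ_eff(1))⁻¹const_e = (a⁻¹+m⁻²)const_e`, `a, m² > 0`),
  ★★★ `effLapU_one_mulVec_const` (`Δ_eff(1)const_e = (a⁻¹+m⁻²)⁻¹const_e` — the softest mode of King's effective Laplacian has mass `am²∕(a+m²) < min(a,m²)`).
* §3 ★★★★ **`l2_opNorm_effLapU_one_inv_eq`** (nonempty fibre: `‖(Δ_eff(1))⁻¹‖ = a⁻¹ + m⁻²` — PARTS Ϥ-k ∕ Ϫ-c ATTAINED), ★★ `floor_le_zeroMode_mass` (PART Ϫ-h's `β₁ ≤ (a⁻¹+m⁻²)⁻¹`),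
  ★★ `re_quadForm_effLapU_one_const` (the form ON the zero mode equals `(a⁻¹+m⁻²)⁻¹‖const_e‖²` — no uniform floor above `am²∕(a+m²)` is possible), ★★ `tendsto_zeroMode_covariance_atTop`
  (`a⁻¹ + m⁻² → ∞` as `m² ↓ 0`: the massless block field has no covariance on the zero mode).
PRIOR TREE ART (by name): Ϫ-a (`cxBlockCov`, `cxBlockCov_inv_of_unitary`, `cxFullOp_zero_inv_eq_covLapF`, `cxEffLap_mul_cxBlockCov`), Ϫ-c (`fib_cxKingQadj_mulVec_site`, `l2_opNorm_effLapU_inv_le`), Ϫ-h (constants `β₁`),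
Ϥ-c (`covQ_const_one_apply`), Ϩ-a (`treeHolRev_const_one`), Ͱ-a∕Ͱ-e (`covLapF_free_mulVec_const`, `covLapF_inv_mul`, `const_ne_zero_of_ne_zero`), Ϥ-k (`isUnit_effLapU`, `effLapU_mul_noise_add_blockAvg`), Mathlib.
Dedup (rg at filing): basename 0 files; needles `covQ_one_mulVec_const|cxBlockCov_one_mulVec_const|l2_opNorm_effLapU_one_inv_eq|zeroMode` 0 tree files.  Locators: [King1986] (2.13)–(2.14) p.653, (4.1) p.670, (4.33) p.674,
(4.44) p.675; [Balaban1985BackgroundPropagators] (3.19) p.393, (3.25) p.394.  0 `sorry`, 0 `def`.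
-/

noncomputable section
open scoped BigOperators ComplexConjugate ComplexOrder Topology Matrix.Norms.L2Operator
open Finset Matrix WithLp Filter

namespace Summit.QuantumFields.YangMills.BalabanUVNodes.N15KingModelRung.Analytic

open Literature.MathematicalPhysics.QuantumFieldTheory.LatticeDiamagneticInequality (blk Hopping)
open Literature.MathematicalPhysics.QuantumFieldTheory.Balaban1983to89.B5Prop11Plancherel (Tor fine)
open Literature.MathematicalPhysics.QuantumFieldTheory.King1986.Torus (site blockOf blockOf_site blockEquiv blockEquiv_apply)
open Summit.QuantumFields.YangMills.BalabanUVNodes.N15KingModelRung.Covariant (covLapF fib fib_apply covLapF_free_mulVec_const covLapF_inv_mul const_ne_zero_of_ne_zero)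
open Summit.QuantumFields.YangMills.BalabanUVNodes.N15KingModelRung.CovariantBlock (BlockTree covQ fullOpU effLapU covQ_const_one_apply isUnit_effLapU effLapU_mul_noise_add_blockAvg)

variable {d : ℕ} {L : ℕ} [NeZero L] (T : BlockTree d L) (M : Fin (d + 1) → ℕ) [hM : ∀ μ, NeZero (M μ)]
variable {𝕜 : Type*} [RCLike 𝕜] {n : Type*} [Fintype n] [DecidableEq n]

/-! ## §1 The block maps and the fine covariance on the constant mode -/

section BlockMaps

/-- ★ **KING's BLOCK MEAN OF A FIBRE-CONSTANT FIELD IS THE SAME CONSTANT**: `Q(1)·const_e = const_e` (each block averages `L^{d+1}` copies of `e` with weight `L^{−(d+1)}`).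
[cite: King1986, (2.11) p.653, (4.1) p.670; Balaban1985BackgroundPropagators, (3.19) p.393] -/
theorem covQ_one_mulVec_const (e : n → 𝕜) : covQ T M (fun _ => (1 : Matrix n n 𝕜)) *ᵥ (fun p : Tor (fine L M) × n => e p.2) = fun q : Tor M × n => e q.2 := by
  have hL : ((L : 𝕜) ^ (d + 1)) ≠ 0 := pow_ne_zero _ (by exact_mod_cast NeZero.ne L)
  funext q
  obtain ⟨y, i⟩ := q
  simp only [Matrix.mulVec, dotProduct]
  rw [Fintype.sum_prod_type]
  simp only [covQ_const_one_apply, ite_mul, zero_mul]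
  have hk : ∀ x : Tor (fine L M), (∑ k : n, if blockOf L M x = y ∧ i = k then ((L : 𝕜) ^ (d + 1))⁻¹ * e k else 0) = if blockOf L M x = y then ((L : 𝕜) ^ (d + 1))⁻¹ * e i else 0 := by
    intro x
    by_cases hx : blockOf L M x = y
    · simp only [hx, true_and, if_true]
      rw [Finset.sum_ite_eq Finset.univ i, if_pos (Finset.mem_univ i)]
    · simp only [hx, false_and, if_false, Finset.sum_const_zero]
  simp_rw [hk]
  rw [← (blockEquiv L M).sum_comp, Fintype.sum_prod_type, Finset.sum_eq_single y]
  · simp only [blockEquiv_apply, blockOf_site, if_true, Finset.sum_const, Finset.card_univ, Fintype.card_fun, Fintype.card_fin, nsmul_eq_mul]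
    push_cast
    rw [← mul_assoc, mul_inv_cancel₀ hL, one_mul]
  · intro y' _ hy'
    exact Finset.sum_eq_zero fun j _ => by rw [blockEquiv_apply, blockOf_site, if_neg hy']
  · intro h; exact absurd (Finset.mem_univ y) h

/-- ★ **KING's CONTINUED `η`-ADJOINT OF A FIBRE-CONSTANT BLOCK FIELD IS THE SAME CONSTANT FINE FIELD**: `Q♯_K(1)·const_e = const_e`. [cite: King1986, (2.13) p.653; Balaban1985BackgroundPropagators, (3.19) p.393] -/
theorem cxKingQadj_one_mulVec_const (e : n → 𝕜) : cxKingQadj T M (fun _ => (1 : Matrix n n 𝕜)) *ᵥ (fun q : Tor M × n => e q.2) = fun p : Tor (fine L M) × n => e p.2 := by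
  funext p
  obtain ⟨x, k⟩ := p
  obtain ⟨⟨y, j⟩, rfl⟩ := (blockEquiv L M).surjective x
  rw [blockEquiv_apply]
  have h := fib_cxKingQadj_mulVec_site T M (fun _ => (1 : Matrix n n 𝕜)) (fun q : Tor M × n => e q.2) y j
  rw [treeHolRev_const_one, Matrix.one_mulVec] at h
  have hk := congrArg (fun w : EuclideanSpace 𝕜 n => w k) h
  simpa only [fib_apply, PiLp.toLp_apply] using hk

/-- THE FINE COVARIANCE ON THE CONSTANT MODE: `(−cΔ + m²)⁻¹const_e = m⁻²·const_e` (`c ≥ 0`, `m² > 0`). [cite: King1986, (4.4) p.670, (4.33) p.674] -/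
theorem covLapF_one_inv_mulVec_const {c m2 : ℝ} (hc : 0 ≤ c) (hm : 0 < m2) (e : n → 𝕜) :
    (covLapF (fine L M) c m2 (fun _ => (1 : Matrix n n 𝕜)))⁻¹ *ᵥ (fun p : Tor (fine L M) × n => e p.2) = ((m2 : 𝕜))⁻¹ • fun p : Tor (fine L M) × n => e p.2 := by
  have hm' : (m2 : 𝕜) ≠ 0 := by exact_mod_cast hm.ne'
  have hfree : (fun _ : Tor (fine L M) × Fin (d + 1) => (1 : Matrix n n 𝕜)) = (Hopping.free : Tor (fine L M) × Fin (d + 1) → Matrix n n 𝕜) := rfl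
  have hBv : covLapF (fine L M) c m2 (fun _ => (1 : Matrix n n 𝕜)) *ᵥ (fun p : Tor (fine L M) × n => e p.2) = (m2 : 𝕜) • fun p => e p.2 := by
    rw [hfree]; exact covLapF_free_mulVec_const (fine L M) c m2 e
  have hinv := covLapF_inv_mul (fine L M) hc hm (U := fun _ : Tor (fine L M) × Fin (d + 1) => (1 : Matrix n n 𝕜)) (fun _ => Submonoid.one_mem _)
  have h : (covLapF (fine L M) c m2 (fun _ => (1 : Matrix n n 𝕜)))⁻¹ *ᵥ (covLapF (fine L M) c m2 (fun _ => (1 : Matrix n n 𝕜)) *ᵥ fun p : Tor (fine L M) × n => e p.2) = fun p => e p.2 := by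
    rw [Matrix.mulVec_mulVec, hinv, Matrix.one_mulVec]
  rw [hBv, Matrix.mulVec_smul] at h
  calc (covLapF (fine L M) c m2 (fun _ => (1 : Matrix n n 𝕜)))⁻¹ *ᵥ (fun p : Tor (fine L M) × n => e p.2)
      = ((m2 : 𝕜))⁻¹ • ((m2 : 𝕜) • ((covLapF (fine L M) c m2 (fun _ => (1 : Matrix n n 𝕜)))⁻¹ *ᵥ fun p : Tor (fine L M) × n => e p.2)) := by rw [smul_smul, inv_mul_cancel₀ hm', one_smul]
    _ = ((m2 : 𝕜))⁻¹ • fun p => e p.2 := by rw [h]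

end BlockMaps

/-! ## §2 The zero mode of the block-field covariance and of the effective Laplacian -/

section ZeroMode

variable {a c m2 : ℝ} (ha : 0 < a) (hc : 0 ≤ c) (hm : 0 < m2)
include ha hc hm

omit ha in
/-- ★★★ **THE ZERO MODE OF NE2's UNIT LAYER**: `C(1,1)·const_e = (a⁻¹ + m⁻²)·const_e` — block-spin noise plus the full infrared pole of the massive fine field.
[cite: King1986, (2.14) p.653, (4.44) p.675; Balaban1985BackgroundPropagators, (3.25) p.394] -/
theorem cxBlockCov_one_mulVec_const (e : n → 𝕜) :
    cxBlockCov T M a c m2 (fun _ => (1 : Matrix n n 𝕜)) (fun bd => ((fun _ : Tor (fine L M) × Fin (d + 1) => (1 : Matrix n n 𝕜)) bd)⁻¹) *ᵥ (fun q : Tor M × n => e q.2)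
      = (((a : 𝕜))⁻¹ + ((m2 : 𝕜))⁻¹) • fun q : Tor M × n => e q.2 := by
  rw [cxBlockCov, cxFullOp_zero_inv_eq_covLapF T M c m2 (U := fun _ => (1 : Matrix n n 𝕜)) (fun _ => Submonoid.one_mem _), Matrix.add_mulVec, Matrix.smul_mulVec, Matrix.one_mulVec,
    ← Matrix.mulVec_mulVec, ← Matrix.mulVec_mulVec]
  simp only [inv_one]
  rw [cxKingQadj_one_mulVec_const, covLapF_one_inv_mulVec_const M hc hm, Matrix.mulVec_smul, covQ_one_mulVec_const, add_smul]

/-- ★★★ **THE ZERO MODE OF KING's BLOCK-FIELD COVARIANCE**: `(Δ_eff(1))⁻¹·const_e = (a⁻¹ + m⁻²)·const_e` (`a, m² > 0`). [cite: King1986, (2.14) p.653, (4.44) p.675] -/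
theorem effLapU_one_inv_mulVec_const (e : n → 𝕜) :
    (effLapU T M a c m2 (fun _ => (1 : Matrix n n 𝕜)))⁻¹ *ᵥ (fun q : Tor M × n => e q.2) = (((a : 𝕜))⁻¹ + ((m2 : 𝕜))⁻¹) • fun q : Tor M × n => e q.2 := by
  rw [← cxBlockCov_inv_of_unitary T M ha hc hm (U := fun _ => (1 : Matrix n n 𝕜)) (fun _ => Submonoid.one_mem _)]
  exact cxBlockCov_one_mulVec_const T M hc hm e

/-- ★★★ **THE SOFTEST MODE OF KING's EFFECTIVE LAPLACIAN**: `Δ_eff(1)·const_e = (a⁻¹ + m⁻²)⁻¹·const_e` — mass `am²∕(a+m²) < min(a, m²)`, the series combination of the block-spin coupling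
and the fine mass. [cite: King1986, (2.14) p.653, (4.33) p.674] -/
theorem effLapU_one_mulVec_const (e : n → 𝕜) :
    effLapU T M a c m2 (fun _ => (1 : Matrix n n 𝕜)) *ᵥ (fun q : Tor M × n => e q.2) = (((a : 𝕜))⁻¹ + ((m2 : 𝕜))⁻¹)⁻¹ • fun q : Tor M × n => e q.2 := by
  have hs : (((a : 𝕜))⁻¹ + ((m2 : 𝕜))⁻¹) ≠ 0 := by
    have : (((a : 𝕜))⁻¹ + ((m2 : 𝕜))⁻¹) = (((a⁻¹ + m2⁻¹ : ℝ)) : 𝕜) := by push_cast; rfl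
    rw [this]; exact_mod_cast (by positivity : (0 : ℝ) < a⁻¹ + m2⁻¹).ne'
  have hΔC : effLapU T M a c m2 (fun _ => (1 : Matrix n n 𝕜)) * (effLapU T M a c m2 (fun _ => (1 : Matrix n n 𝕜)))⁻¹ = 1 :=
    Matrix.mul_nonsing_inv _ ((Matrix.isUnit_iff_isUnit_det _).mp (isUnit_effLapU T M ha hc hm (U := fun _ => (1 : Matrix n n 𝕜)) (fun _ => Submonoid.one_mem _)))
  have h : effLapU T M a c m2 (fun _ => (1 : Matrix n n 𝕜)) *ᵥ ((effLapU T M a c m2 (fun _ => (1 : Matrix n n 𝕜)))⁻¹ *ᵥ fun q : Tor M × n => e q.2) = fun q => e q.2 := by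
    rw [Matrix.mulVec_mulVec, hΔC, Matrix.one_mulVec]
  rw [effLapU_one_inv_mulVec_const T M ha hc hm, Matrix.mulVec_smul] at h
  calc effLapU T M a c m2 (fun _ => (1 : Matrix n n 𝕜)) *ᵥ (fun q : Tor M × n => e q.2)
      = (((a : 𝕜))⁻¹ + ((m2 : 𝕜))⁻¹)⁻¹ • ((((a : 𝕜))⁻¹ + ((m2 : 𝕜))⁻¹) • (effLapU T M a c m2 (fun _ => (1 : Matrix n n 𝕜)) *ᵥ fun q : Tor M × n => e q.2)) := by
          rw [smul_smul, inv_mul_cancel₀ hs, one_smul]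
    _ = (((a : 𝕜))⁻¹ + ((m2 : 𝕜))⁻¹)⁻¹ • fun q => e q.2 := by rw [h]

end ZeroMode

/-! ## §3 The sandwich is attained; the floor is pinched; the infrared limit -/

section Sharp

variable {D : ℕ} (hD : ∀ j, T.depth j ≤ D) {a c m2 : ℝ} (ha : 0 < a) (hc : 0 ≤ c) (hm : 0 < m2)
include hD ha hc hm

/-- ★★★★ **PART Ϥ-k's SANDWICH AND PART Ϫ-c's OPERATOR BOUND ARE ATTAINED AT THE TRIVIAL BACKGROUND**: for a nonempty fibre, `‖(Δ_eff(1))⁻¹‖ = a⁻¹ + m⁻²` exactly (every tree contour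
system, every volume). [cite: King1986, (2.14) p.653, (4.33) p.674, (4.44) p.675; Balaban1985BackgroundPropagators, (3.25) p.394] -/
theorem l2_opNorm_effLapU_one_inv_eq [Nonempty n] : ‖(effLapU T M a c m2 (fun _ => (1 : Matrix n n 𝕜)))⁻¹‖ = a⁻¹ + m2⁻¹ := by
  refine le_antisymm (l2_opNorm_effLapU_inv_le T M hD ha hc hm (U := fun _ => (1 : Matrix n n 𝕜)) (fun _ => Submonoid.one_mem _)) ?_
  -- the constant mode realises the bound
  set v : Tor M × n → 𝕜 := fun q => (1 : 𝕜) with hv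
  have hv0 : v ≠ 0 := const_ne_zero_of_ne_zero M (e := fun _ : n => (1 : 𝕜)) (Function.ne_iff.mpr ⟨Classical.arbitrary n, one_ne_zero⟩)
  have hXv : (effLapU T M a c m2 (fun _ => (1 : Matrix n n 𝕜)))⁻¹ *ᵥ v = (((a⁻¹ + m2⁻¹ : ℝ)) : 𝕜) • v := by
    have h := effLapU_one_inv_mulVec_const T M ha hc hm (fun _ : n => (1 : 𝕜))
    rw [show (fun q : Tor M × n => (fun _ : n => (1 : 𝕜)) q.2) = v from rfl] at h
    rw [h]; congr 1; push_cast; rfl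
  have hpos : 0 < ‖(toLp 2 v : EuclideanSpace 𝕜 (Tor M × n))‖ := by
    have : (toLp 2 v : EuclideanSpace 𝕜 (Tor M × n)) ≠ 0 := fun h0 => hv0 (by simpa using congrArg ofLp h0)
    positivity
  have h := Matrix.l2_opNorm_mulVec (effLapU T M a c m2 (fun _ => (1 : Matrix n n 𝕜)))⁻¹ (toLp 2 v : EuclideanSpace 𝕜 (Tor M × n))
  have e : ‖(EuclideanSpace.equiv (Tor M × n) 𝕜).symm ((effLapU T M a c m2 (fun _ => (1 : Matrix n n 𝕜)))⁻¹ *ᵥ ⇑(toLp 2 v : EuclideanSpace 𝕜 (Tor M × n)))‖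
      = (a⁻¹ + m2⁻¹) * ‖(toLp 2 v : EuclideanSpace 𝕜 (Tor M × n))‖ := by
    rw [show ⇑(toLp 2 v : EuclideanSpace 𝕜 (Tor M × n)) = v from rfl, hXv,
      show (EuclideanSpace.equiv (Tor M × n) 𝕜).symm ((((a⁻¹ + m2⁻¹ : ℝ)) : 𝕜) • v) = (((a⁻¹ + m2⁻¹ : ℝ)) : 𝕜) • (toLp 2 v : EuclideanSpace 𝕜 (Tor M × n)) from rfl,
      norm_smul, RCLike.norm_ofReal, abs_of_pos (by positivity)]
  rw [e] at h
  exact le_of_mul_le_mul_right h hpos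

omit hD hc in
/-- ★★ **PART Ϫ-h's `η`-UNIFORM FLOOR IS CONSISTENT WITH THE ZERO MODE**: `β₁ = (a⁻¹∕2)∕(a⁻¹+4e∕m²)² ≤ (a⁻¹ + m⁻²)⁻¹ = am²∕(a+m²)` — no uniform floor can exceed the zero-mode mass. [folklore] -/
theorem floor_le_zeroMode_mass : (a⁻¹ / 2) / (a⁻¹ + 4 / m2 * Real.exp 1) ^ 2 ≤ (a⁻¹ + m2⁻¹)⁻¹ := by
  have he : (1 : ℝ) ≤ Real.exp 1 := Real.one_le_exp (by norm_num)
  have ha' : 0 < a⁻¹ := inv_pos.2 ha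
  have hm' : 0 < m2⁻¹ := inv_pos.2 hm
  set s := a⁻¹ + m2⁻¹ with hs
  set S := a⁻¹ + 4 / m2 * Real.exp 1 with hS
  have hsS : s ≤ S := by rw [hs, hS, div_eq_mul_inv]; nlinarith
  have hs0 : 0 < s := by positivity
  have hS0 : 0 < S := by positivity
  rw [div_le_iff₀ (by positivity : (0 : ℝ) < S ^ 2)]
  -- `a⁻¹∕2 ≤ s ≤ s⁻¹·S²` since `S ≥ s ≥ a⁻¹ > 0`
  have h2 : a⁻¹ / 2 ≤ s := by rw [hs]; linarith
  have hsq : s ^ 2 ≤ S ^ 2 := pow_le_pow_left₀ hs0.le hsS 2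
  have h3 : s ≤ s⁻¹ * S ^ 2 := by
    calc s = s⁻¹ * s ^ 2 := by field_simp
      _ ≤ s⁻¹ * S ^ 2 := mul_le_mul_of_nonneg_left hsq (inv_nonneg.2 hs0.le)
  linarith

omit hD in
/-- ★★ **ON THE ZERO MODE THE FORM IS EXACTLY `(a⁻¹+m⁻²)⁻¹‖const‖²`**: `Re⟨const_e, Δ_eff(1)const_e⟩ = (a⁻¹+m⁻²)⁻¹·‖const_e‖²`. [cite: King1986, (2.14) p.653, (4.33) p.674] -/
theorem re_quadForm_effLapU_one_const (e : n → 𝕜) :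
    RCLike.re (star (fun q : Tor M × n => e q.2) ⬝ᵥ (effLapU T M a c m2 (fun _ => (1 : Matrix n n 𝕜)) *ᵥ fun q : Tor M × n => e q.2))
      = (a⁻¹ + m2⁻¹)⁻¹ * ‖(toLp 2 (fun q : Tor M × n => e q.2) : EuclideanSpace 𝕜 (Tor M × n))‖ ^ 2 := by
  rw [effLapU_one_mulVec_const T M ha hc hm, dotProduct_smul, smul_eq_mul,
    show (((a : 𝕜))⁻¹ + ((m2 : 𝕜))⁻¹)⁻¹ = ((((a⁻¹ + m2⁻¹)⁻¹ : ℝ)) : 𝕜) by push_cast; rfl, RCLike.re_ofReal_mul, EuclideanSpace.norm_sq_eq,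
    Literature.LinearAlgebra.Matrix.RayleighQuotient.re_star_dotProduct_self]

omit hD ha hc hm in
/-- ★★ **THE INFRARED LIMIT**: the zero-mode covariance `a⁻¹ + m⁻²` diverges as `m² ↓ 0` — the massless block field has no covariance on the constants; the window of the PART closes with
the fine mass for this reason. [cite: King1986, (4.33) p.674] -/
theorem tendsto_zeroMode_covariance_atTop (a : ℝ) : Tendsto (fun m2 : ℝ => a⁻¹ + m2⁻¹) (𝓝[>] 0) atTop :=
  tendsto_atTop_add_const_left _ _ tendsto_inv_nhdsGT_zero

end Sharp

end Summit.QuantumFields.YangMills.BalabanUVNodes.N15KingModelRung.Analytic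

end
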